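import Summits.RiemannHypothesis.RiemannHypothesis.Theorems.GapsEvoDoorsWindowPairCount

/-!
# GapsEvoDoors — the WINDOW form of Bui–Goldston–Milinovich–Montgomery's Theorem 3 (part 2: the assembly)

Part 1 (`GapsEvoDoorsWindowPairCount.lean`) proves the window Proposition 1
`pairCount_ge_window`. This part re-runs the §4 assembly of Bui–Goldston–Milinovich–Montgomery
2023 (arXiv:2208.02359), Theorem 3 first clause, from a PAIR-COUNT HYPOTHESIS
(`spacingDensityPos_of_pairCount`; verbatim the tree's `BGMM2023.spacingDensityPos_of_RH` with
Proposition 1 replaced by the hypothesis: `Σ_n ν(n) ≥ cN/4`, Cauchy, `#{ν ≥ 1} ≤ #spacings`,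
`Σν² ≤ ΣW² ≪ N(T)` = Proposition 2, tree `BGMM2023.sum_windowCount_pow_le_count_of_RH`), and
packages both parts as the WINDOW CRITERION `spacingDensityPos_window`: under RH, an admissible `r`
(even, continuous, `L¹`, `r̂ ∈ L¹`, `r ≤ 1`, `r ≤ 0` off `[−λ, λ]`, `r̂ ≥ 0` for `|α| ≥ Δ`) and an
even continuous eventual minorant `m ≤ F·r̂` on `1 < |α| ≤ Δ` with
`r̂(0) − 1 + 2∫₀¹ α r̂ + 2∫₁^Δ m > 0` give `SpacingDensityPos λ`. The route items
`FloorSpacingCriterionAll` (23032) and `FFSpacingCriterionAll` (22422) are its specialisations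
(`GapsEvoDoorsFloorSpacingCriterion.lean`, `GapsEvoDoorsFFSpacingCriterion.lean`). RH is an
explicit hypothesis; nothing here bears on the truth of RH.
-/

noncomputable section

open Filter Set MeasureTheory Finset Real

set_option linter.dupNamespace false  -- the mandated namespace repeats `RiemannHypothesis`

namespace Summit.RiemannHypothesis.RiemannHypothesis.Theorems.GapsEvoDoorsWindow

open Literature.NumberTheory.LFunctions Literature.NumberTheory.LFunctions.BGMM2023

/-- **Theorem 3 (first clause) from a pair count.** Under RH, if for some `c > 0` and all large `T`
`(1 + c/2) N(T) ≤ #{(γ, γ') ∈ (0,T]² : |γ − γ'| ≤ 2πλ/log T}` (`λ > 0`), then a positive proportion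
of the spacings are `≤ 2πλ/log T` (`SpacingDensityPos λ`). The §4 assembly of the tree's
`BGMM2023.spacingDensityPos_of_RH`, with Proposition 1 replaced by the hypothesis:
`Σ_n ν(n) ≥ c N/4`, Cauchy `(Σν)² ≤ #{ν ≥ 1}·Σν²`, `#{ν ≥ 1} ≤ #spacings`, `Σν² ≤ ΣW² ≪ N(T)`
(Proposition 2, `BGMM2023.sum_windowCount_pow_le_count_of_RH`). -/
theorem spacingDensityPos_of_pairCount (hRH : RiemannHypothesis) {lam : ℝ} (hlam : 0 < lam)
    {c : ℝ} (hc : 0 < c)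
    (hP : ∃ T₁ : ℝ, ∀ T : ℝ, T₁ ≤ T →
      (1 + c / 2) * (zetaZeroCount T : ℝ) ≤ (pairCorrelationCount (-lam) lam T : ℝ)) :
    SpacingDensityPos lam := by
  classical
  obtain ⟨T₁, hP⟩ := hP
  obtain ⟨C₂, T₂, hC₂, hW⟩ := sum_windowCount_pow_le_count_of_RH hRH hlam 2
  refine ⟨c ^ 2 / (16 * C₂), by positivity, max T₁ (max T₂ 2), fun T hT ↦ ?_⟩
  have hT₁ : T₁ ≤ T := le_trans (le_max_left _ _) hT
  have hT₂ : T₂ ≤ T := le_trans ((le_max_left _ _).trans (le_max_right _ _)) hT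
  have hT2 : (2 : ℝ) ≤ T := le_trans ((le_max_right _ _).trans (le_max_right _ _)) hT
  have hL : 0 < Real.log T := Real.log_pos (by linarith)
  set δ : ℝ := 2 * π * lam / Real.log T with hδdef
  have hδ : 0 < δ := by positivity
  set N : ℕ := zetaZeroCount T with hNdef
  set ν : ℕ → ℕ := fun n ↦
    ((Finset.range N).filter fun m ↦ n < m ∧ zetaOrdinate m - zetaOrdinate n ≤ δ).card with hνdef
  -- (i) `#pairs ≤ N + 2 Σ ν`
  have h1 : (pairCorrelationCount (-lam) lam T : ℝ) ≤ N + 2 * ∑ n ∈ Finset.range N, (ν n : ℝ) := by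
    have e : pairCorrelationCount (-lam) lam T =
        ((Finset.range N ×ˢ Finset.range N).filter fun p : ℕ × ℕ ↦
          -δ ≤ zetaOrdinate p.1 - zetaOrdinate p.2 ∧ zetaOrdinate p.1 - zetaOrdinate p.2 ≤ δ).card := by
      unfold pairCorrelationCount zeroIndexSet
      congr 1
      refine Finset.filter_congr fun p _ ↦ ?_
      rw [show 2 * π * -lam / Real.log T = -δ by rw [hδdef]; ring]
    rw [e]
    exact_mod_cast card_pairFilter_le N δ
  -- (ii) `Σ ν ≥ c N / 4`
  have h2 : c / 4 * N ≤ ∑ n ∈ Finset.range N, (ν n : ℝ) := by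
    have hp := hP T hT₁
    linarith
  -- (iii) Cauchy
  have h3 := sq_sum_le_card_pos_mul_sum_sq (Finset.range N) ν
  -- (iv) `#{ν ≥ 1} ≤ #spacings`
  have h4 : (((Finset.range N).filter fun n ↦ 1 ≤ ν n).card : ℝ) ≤ spacingCount lam T := by
    unfold spacingCount
    exact_mod_cast card_filter_latePos_le N δ
  -- (v) `Σ ν² ≤ C₂ N`
  have h5 : ∑ n ∈ Finset.range N, (ν n : ℝ) ^ 2 ≤ C₂ * N := by
    have hW' := hW T hT₂
    refine le_trans (Finset.sum_le_sum fun n _ ↦ ?_) hW'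
    exact pow_le_pow_left₀ (Nat.cast_nonneg _) (card_late_le_windowCount hδ N n) 2
  -- (vi) conclusion
  have hS0 : (0 : ℝ) ≤ spacingCount lam T := Nat.cast_nonneg _
  have key : c ^ 2 / 16 * (N : ℝ) ^ 2 ≤ spacingCount lam T * (C₂ * N) := by
    have hcN : 0 ≤ c / 4 * (N : ℝ) := by positivity
    calc c ^ 2 / 16 * (N : ℝ) ^ 2 = (c / 4 * N) ^ 2 := by ring
      _ ≤ (∑ n ∈ Finset.range N, (ν n : ℝ)) ^ 2 := pow_le_pow_left₀ hcN h2 2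
      _ ≤ _ := h3
      _ ≤ spacingCount lam T * (C₂ * N) :=
          mul_le_mul h4 h5 (Finset.sum_nonneg fun n _ ↦ by positivity) hS0
  rcases Nat.eq_zero_or_pos N with hN0 | hNpos
  · rw [hN0]; simp
  · have hNr : (0 : ℝ) < N := by exact_mod_cast hNpos
    have hCN : 0 < C₂ * (N : ℝ) := mul_pos hC₂ hNr
    have e : c ^ 2 / (16 * C₂) * (N : ℝ) = c ^ 2 / 16 * (N : ℝ) ^ 2 / (C₂ * N) := by
      field_simp
    rw [e, div_le_iff₀ hCN]
    exact key

/-- **The window criterion.** Under RH: `λ > 0`, `Δ ≥ 1`, `r` even, continuous, `L¹`, `r̂ ∈ L¹`,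
`r ≤ 1`, `r ≤ 0` off `[−λ, λ]`, `r̂ ≥ 0` for `|α| ≥ Δ`, an even continuous `m` with
`m(α) ≤ F(α, T) r̂(α)` on `1 < |α| ≤ Δ` for all large `T`, and
`r̂(0) − 1 + 2∫₀¹ α r̂ + 2∫₁^Δ m > 0` ⇒ a positive proportion of spacings `≤ 2πλ/log T`. -/
theorem spacingDensityPos_window (hRH : RiemannHypothesis) {lam Δ : ℝ} (hlam : 0 < lam) (hΔ : 1 ≤ Δ)
    {r : ℝ → ℝ} (hev : ∀ u, r (-u) = r u) (hco : Continuous r) (hin : Integrable r)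
    (hti : Integrable (cosTransform r)) (hle : ∀ u, r u ≤ 1) (hno : ∀ u, lam < |u| → r u ≤ 0)
    (htail : ∀ α, Δ ≤ |α| → 0 ≤ cosTransform r α)
    {m : ℝ → ℝ} (hmc : Continuous m) (hme : ∀ a, m (-a) = m a)
    (hwin : ∃ T₀ : ℝ, ∀ T : ℝ, T₀ ≤ T → ∀ α : ℝ, 1 < |α| → |α| ≤ Δ →
        m α ≤ montgomeryFormFactor α T * cosTransform r α)
    (hpos : 0 < cosTransform r 0 - 1 + 2 * (∫ a in (0 : ℝ)..1, a * cosTransform r a)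
        + 2 * (∫ a in (1 : ℝ)..Δ, m a)) :
    SpacingDensityPos lam := by
  set c : ℝ := cosTransform r 0 - 1 + 2 * (∫ a in (0 : ℝ)..1, a * cosTransform r a)
      + 2 * (∫ a in (1 : ℝ)..Δ, m a) with hcdef
  obtain ⟨T₀, h⟩ := pairCount_ge_window hRH hΔ hev hco hin hti hle hno htail hmc hme hwin
    (half_pos hpos)
  refine spacingDensityPos_of_pairCount hRH hlam hpos ⟨T₀, fun T hT ↦ ?_⟩
  have h1 := h T hT
  have e : cosTransform r 0 + 2 * (∫ a in (0 : ℝ)..1, a * cosTransform r a)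
      + 2 * (∫ a in (1 : ℝ)..Δ, m a) - c / 2 = 1 + c / 2 := by
    rw [hcdef]; ring
  rw [e] at h1
  exact h1

end Summit.RiemannHypothesis.RiemannHypothesis.Theorems.GapsEvoDoorsWindow

end
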